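import Summits.BirchSwinnertonDyer.BirchSwinnertonDyer.Theorems.KimAtThreeDeepLowerPortDeepTorsionUpper
import HarnessLib

/-!
# Route `KimAtThreeKolyvagin` (rung W2): PORT@3-TORS-DEEP as ONE ITEM TEXT in the route file's vocabulary and the
# bridge to the consumers' two-exponent currency (so that ONE first-layer item carries 19075 / 19076 / 19562 / 19679
# and `N11.KimAtThreeDeepPUB` at every row)

Cell `bsd-addord`, seat `bsd-addord-w2-c2` (gen 6; `--supports stmt-BirchSwinnertonDyer-19075`).
HONEST FRAMING. TOOL theorems only (no definition, no named fact, no `sorry`); nothing asserted, nothing booked;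
every item stays OPEN; BSD is not proved by any of this.  The ITEM TEXTS (kernel-checked to elaborate in
`namespace …Theses.KimAtThreeKolyvagin` with the route file as only import; HOME/w2c2/PORT-TORS-DEEP-{ALL,OFF}-SIGNATURE-g6.txt)
= w2-c4 g7's PORT-{ALL,OFF}-SIGNATURE-g7 texts (n1011's ONE-exponent clauses `GaloisImage.KatoKuriharaWitnessAt`) with:
`#E(ℚ₃)[3] = 1` ↦ `∀ t M, #E(ℚ₃)[3] = 3^t →`, the torsion-STABILITY antecedent at `M`
(`∀ Q : E(ℚ_{v₃}), 3^{M+1}·Q = 0 → 3^M·Q = 0`, n1011 T-DER-BP's `hstab`), the With-guards `(k + M) k` /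
`(k′ + M) k′` (DEEP classes, [MR04] App. A Prop. A.2) and the value law's `t`-slot `t`.  FLAG `K22-Thm3.13-PORT@3`;
NOT in print at `3`.  At `t = 0`, `M = 0` the clauses are w2-c4's PORT@3-ALL / -OFF.
* `portDeepAll_of_portDeepAllWitnessAt` / `portDeepOff_of_portDeepOffWitnessAt` — item text ⟹ the consumers'
  `∃ e` two-exponent port (`e = 0`: `KimAtThreeKolyvaginDefs.katoKuriharaWitnessAtTwoExp_zero_of_witnessAt`; the
  converse as hypotheses holds by scaling Kato's families by `3^e`, acc6's `katoKuriharaWitnessAt_smul_of_witnessAtTwoExp`).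
ONE-LINE CLOSES from {the four published leaves, the ALL item text `hI`} (not restated — gate dedup):
`…PortDeepTorsionCruxes.deepLowerAtThree_of_lit_of_portDeepAll (portDeepAll_of_portDeepAllWitnessAt hI) hS24 hS24₂ hGZK hPT hlev`
(19075), `…PortDeepTorsionUpper.deepUpperAtThree_of_lit_of_portDeepAll (…) …` (19076),
`…PortDeepTorsionUpper.kimAtThreeDeepPUB_of_lit_of_portDeepAll (…) …` (`N11.KimAtThreeDeepPUB`); from the OFF text:
`…PortDeepTorsionCruxes.deepLowerAtThreeOffKatoStratum_of_sak_of_portDeepOff (portDeepOff_of_portDeepOffWitnessAt hO) hSak hGZK hPT`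
(19679), `…PortDeepTorsionUpper.deepUpperAtThreeOffKatoStratum_of_sak_of_portDeepOff (…) …` (19562).
References: [MazurRubin2004] App. A Prop. A.2; [Kim2022StructureSelmer] Thm. 3.13; [Kato2004Asterisque] Thm. 12.5 (1).
-/

set_option autoImplicit false
-- the Theorems namespace of a single-conjunct summit repeats the summit name by design (D-0017)
set_option linter.dupNamespace false

noncomputable section

open scoped Classical NumberField ContRepresentation
open Function Field NumberField IsDedekindDomain IsDedekindDomain.HeightOneSpectrum WeierstrassCurve
  CongruenceSubgroup
  Literature.NumberTheory.EllipticCurves Literature.NumberTheory.EllipticCurves.ModularForms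
  Literature.NumberTheory.EllipticCurves.Rank1Residual
  Literature.NumberTheory.GaloisRepresentations
  Literature.NumberTheory.GaloisRepresentations.DiscreteGaloisModule Literature.NumberTheory.GaloisCohomology
  Rat.HeightOneSpectrum
  Summit.BirchSwinnertonDyer.Rank1Residual.GaloisImage
  Summit.BirchSwinnertonDyer.Rank1Residual.GaloisImage.Assembly
  Summit.BirchSwinnertonDyer.Rank1Residual.X4

namespace Summit.BirchSwinnertonDyer.BirchSwinnertonDyer.Theorems.KimAtThreeDeepLowerPortDeepTorsionItem

open Summit.BirchSwinnertonDyer.BirchSwinnertonDyer.Theorems.KimAtThreeKolyvaginDefs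

/-! ### §1 PORT@3-TORS-DEEP-ALL -/

section ItemAll

/- HOME/w2c2/PORT-TORS-DEEP-ALL-SIGNATURE-g6.txt verbatim (one-exponent, route-file vocabulary). -/
variable
  (hI : ∀ (W₀ : WeierstrassCurve ℚ) [W₀.IsElliptic] [W₀.IsGloballyMinimal], (∀ n : ℕ, W₀.HasSurjectiveModNGaloisRep (3 ^ n : ℕ)) →
      ∀ (t M : ℕ), Nat.card {Q : (W₀.baseChange ℚ_[3]).toAffine.Point // (3 : ℕ) • Q = 0} = 3 ^ t →
      ∀ (v₃ : IsDedekindDomain.HeightOneSpectrum (NumberField.RingOfIntegers ℚ)), ((3 : ℕ) : NumberField.RingOfIntegers ℚ) ∈ v₃.asIdeal →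
      (∀ Q : (W₀.baseChange (IsDedekindDomain.HeightOneSpectrum.adicCompletion ℚ v₃)).toAffine.Point, 3 ^ (M + 1) • Q = 0 →
      3 ^ M • Q = 0) → ∀ (η : (q : IsDedekindDomain.HeightOneSpectrum (NumberField.RingOfIntegers ℚ)) →
      (ZMod (Ideal.absNorm q.asIdeal))ˣ), (∀ q, Subgroup.zpowers (η q) = ⊤) →
      ∀ {N : ℕ} [NeZero N] (P : Literature.NumberTheory.EllipticCurves.ModularForms.ModularParametrizationData W₀ N), N = W₀.conductorNorm ℤ →
      (∀ z ∈ P.L.lattice, ∃ w ∈ Literature.NumberTheory.EllipticCurves.ModularForms.periodLattice P.f, z = P.c * w) →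
      ∀ (k k' : ℕ) (Dk : Literature.NumberTheory.GaloisCohomology.KolyvaginDatum (W₀.torsionGaloisModule (((3 : ℕ) : ℤ) ^ k * ((3 : ℕ) : ℤ)))) (Dk' : Literature.NumberTheory.GaloisCohomology.KolyvaginDatum (W₀.torsionGaloisModule (((3 : ℕ) : ℤ) ^ k' * ((3 : ℕ) : ℤ)))) (red : ContIntertwiningMap (W₀.torsionGaloisModule (((3 : ℕ) : ℤ) ^ k' * ((3 : ℕ) : ℤ))).toContRepresentation (W₀.torsionGaloisModule (((3 : ℕ) : ℤ) ^ k * ((3 : ℕ) : ℤ))).toContRepresentation), Dk.IsCanonicalTauDatumThreeAtWith W₀ (k + M) k η →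
      Dk'.IsCanonicalTauDatumThreeAtWith W₀ (k' + M) k' η → k ≤ k' →
      (∀ x : W₀.geomTorsion (((3 : ℕ) : ℤ) ^ k' * ((3 : ℕ) : ℤ)), ((red x : W₀.geomTorsion (((3 : ℕ) : ℤ) ^ k * ((3 : ℕ) : ℤ))) : W₀.geomPoints) = (((3 : ℕ) : ℤ) ^ (k' - k)) • (x : W₀.geomPoints)) →
      ∃ κ Λ κ' κu Λu κu', Summit.BirchSwinnertonDyer.Rank1Residual.GaloisImage.KatoKuriharaWitnessAt W₀ k t Dk v₃ P κ Λ κ' ∧ Summit.BirchSwinnertonDyer.Rank1Residual.GaloisImage.KatoKuriharaWitnessAt W₀ k' t Dk' v₃ P κu Λu κu' ∧ ∀ d, Dk'.IsLevel d →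
      Dk.IsLevel d →
      Literature.NumberTheory.GaloisRepresentations.galoisCohomology.map red 1 (κu d) = κ d ∧ Literature.NumberTheory.GaloisRepresentations.galoisCohomology.map red 1 (κu' d) = κ' d)

include hI

/-- **The ALL item text gives the consumers' two-exponent `∃ e` port PORT@3-TORS-DEEP-ALL** (take `e = 0`).
[cite: Kim2022StructureSelmer, Thm. 3.13 (arXiv p. 17)] [cite: Kato2004Asterisque, Thm. 12.5 (1)] -/
theorem portDeepAll_of_portDeepAllWitnessAt :
    ∀ (W₀ : WeierstrassCurve ℚ) [W₀.IsElliptic] [W₀.IsGloballyMinimal],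
    (∀ n : ℕ, W₀.HasSurjectiveModNGaloisRep (3 ^ n : ℕ)) →
    ∀ (t M : ℕ), Nat.card {Q : (W₀.baseChange ℚ_[3]).toAffine.Point // (3 : ℕ) • Q = 0} = 3 ^ t →
    ∀ (v₃ : HeightOneSpectrum (𝓞 ℚ)), ((3 : ℕ) : 𝓞 ℚ) ∈ v₃.asIdeal →
    (∀ Q : (W₀.baseChange (v₃.adicCompletion ℚ)).toAffine.Point, 3 ^ (M + 1) • Q = 0 → 3 ^ M • Q = 0) →
    ∀ (η : (q : HeightOneSpectrum (𝓞 ℚ)) → (ZMod (Ideal.absNorm q.asIdeal))ˣ),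
      (∀ q, Subgroup.zpowers (η q) = ⊤) →
    ∀ {N : ℕ} [NeZero N] (P : ModularParametrizationData W₀ N), N = W₀.conductorNorm ℤ →
      (∀ z ∈ P.L.lattice, ∃ w ∈ periodLattice P.f, z = P.c * w) →
      ∃ e : ℕ, ∀ (k k' : ℕ)
        (Dk : KolyvaginDatum (W₀.torsionGaloisModule (((3 : ℕ) : ℤ) ^ k * ((3 : ℕ) : ℤ))))
        (Dk' : KolyvaginDatum (W₀.torsionGaloisModule (((3 : ℕ) : ℤ) ^ k' * ((3 : ℕ) : ℤ))))
        (red : (W₀.torsionGaloisModule (((3 : ℕ) : ℤ) ^ k' * ((3 : ℕ) : ℤ))).toContRepresentation →ⁱL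
          (W₀.torsionGaloisModule (((3 : ℕ) : ℤ) ^ k * ((3 : ℕ) : ℤ))).toContRepresentation),
        Dk.IsCanonicalTauDatumThreeAtWith W₀ (k + M) k η → Dk'.IsCanonicalTauDatumThreeAtWith W₀ (k' + M) k' η →
        k ≤ k' →
        (∀ x : geomTorsion W₀ (((3 : ℕ) : ℤ) ^ k' * ((3 : ℕ) : ℤ)),
          ((red x : geomTorsion W₀ (((3 : ℕ) : ℤ) ^ k * ((3 : ℕ) : ℤ))) : geomPoints W₀) =
            (((3 : ℕ) : ℤ) ^ (k' - k)) • (x : geomPoints W₀)) →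
        ∃ κ Λ κ' κu Λu κu',
          KatoKuriharaWitnessAtTwoExp W₀ k t e Dk v₃ P κ Λ κ' ∧
          KatoKuriharaWitnessAtTwoExp W₀ k' t e Dk' v₃ P κu Λu κu' ∧
          ∀ d, Dk'.IsLevel d → Dk.IsLevel d →
            galoisCohomology.map red 1 (κu d) = κ d ∧ galoisCohomology.map red 1 (κu' d) = κ' d := by
  intro W₀ _ _ htow t M ht v₃ hv₃ hM η hη N _ P hN hopt
  refine ⟨0, fun k k' Dk Dk' red hDk hDk' hk hred => ?_⟩
  obtain ⟨κ, Λ, κ', κu, Λu, κu', hW, hW', hcomp⟩ := hI W₀ htow t M ht v₃ hv₃ hM η hη P hN hopt k k' Dk Dk' red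
    hDk hDk' hk hred
  exact ⟨κ, Λ, κ', κu, Λu, κu', katoKuriharaWitnessAtTwoExp_zero_of_witnessAt hW,
    katoKuriharaWitnessAtTwoExp_zero_of_witnessAt hW', hcomp⟩

end ItemAll

/-! ### §2 PORT@3-TORS-DEEP-OFF -/

section ItemOff

/- HOME/w2c2/PORT-TORS-DEEP-OFF-SIGNATURE-g6.txt verbatim. -/
variable
  (hO : ∀ (W₀ : WeierstrassCurve ℚ) [W₀.IsElliptic] [W₀.IsGloballyMinimal], (∀ n : ℕ, W₀.HasSurjectiveModNGaloisRep (3 ^ n : ℕ)) →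
      ∀ (t M : ℕ), Nat.card {Q : (W₀.baseChange ℚ_[3]).toAffine.Point // (3 : ℕ) • Q = 0} = 3 ^ t →
      ∀ (v₃ : IsDedekindDomain.HeightOneSpectrum (NumberField.RingOfIntegers ℚ)), ((3 : ℕ) : NumberField.RingOfIntegers ℚ) ∈ v₃.asIdeal →
      (∀ Q : (W₀.baseChange (IsDedekindDomain.HeightOneSpectrum.adicCompletion ℚ v₃)).toAffine.Point, 3 ^ (M + 1) • Q = 0 →
      3 ^ M • Q = 0) → ∀ (η : (q : IsDedekindDomain.HeightOneSpectrum (NumberField.RingOfIntegers ℚ)) →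
      (ZMod (Ideal.absNorm q.asIdeal))ˣ), (∀ q, Subgroup.zpowers (η q) = ⊤) →
      ∀ {N : ℕ} [NeZero N] (P : Literature.NumberTheory.EllipticCurves.ModularForms.ModularParametrizationData W₀ N), N = W₀.conductorNorm ℤ →
      (∀ z ∈ P.L.lattice, ∃ w ∈ Literature.NumberTheory.EllipticCurves.ModularForms.periodLattice P.f, z = P.c * w) →
      ¬ ((haveI : Fact (Nat.Prime 3) := ⟨Nat.prime_three⟩; Literature.NumberTheory.EllipticCurves.Rank1Residual.Addv W₀ 3) ∧ ¬ 3 ∣ (W₀.baseChange ℚ_[3]).localTamagawaNumber ℤ_[3] ∧ Nat.card {Q : (W₀.baseChange ℚ_[3]).toAffine.Point // (3 : ℕ) • Q = 0} = 1 ∧ ¬ (3 : ℤ) ∣ P.maninConstant) →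
      ∀ (k k' : ℕ) (Dk : Literature.NumberTheory.GaloisCohomology.KolyvaginDatum (W₀.torsionGaloisModule (((3 : ℕ) : ℤ) ^ k * ((3 : ℕ) : ℤ)))) (Dk' : Literature.NumberTheory.GaloisCohomology.KolyvaginDatum (W₀.torsionGaloisModule (((3 : ℕ) : ℤ) ^ k' * ((3 : ℕ) : ℤ)))) (red : ContIntertwiningMap (W₀.torsionGaloisModule (((3 : ℕ) : ℤ) ^ k' * ((3 : ℕ) : ℤ))).toContRepresentation (W₀.torsionGaloisModule (((3 : ℕ) : ℤ) ^ k * ((3 : ℕ) : ℤ))).toContRepresentation), Dk.IsCanonicalTauDatumThreeAtWith W₀ (k + M) k η →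
      Dk'.IsCanonicalTauDatumThreeAtWith W₀ (k' + M) k' η → k ≤ k' →
      (∀ x : W₀.geomTorsion (((3 : ℕ) : ℤ) ^ k' * ((3 : ℕ) : ℤ)), ((red x : W₀.geomTorsion (((3 : ℕ) : ℤ) ^ k * ((3 : ℕ) : ℤ))) : W₀.geomPoints) = (((3 : ℕ) : ℤ) ^ (k' - k)) • (x : W₀.geomPoints)) →
      ∃ κ Λ κ' κu Λu κu', Summit.BirchSwinnertonDyer.Rank1Residual.GaloisImage.KatoKuriharaWitnessAt W₀ k t Dk v₃ P κ Λ κ' ∧ Summit.BirchSwinnertonDyer.Rank1Residual.GaloisImage.KatoKuriharaWitnessAt W₀ k' t Dk' v₃ P κu Λu κu' ∧ ∀ d, Dk'.IsLevel d →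
      Dk.IsLevel d →
      Literature.NumberTheory.GaloisRepresentations.galoisCohomology.map red 1 (κu d) = κ d ∧ Literature.NumberTheory.GaloisRepresentations.galoisCohomology.map red 1 (κu' d) = κ' d)

include hO

/-- **The OFF item text gives the consumers' two-exponent `∃ e` port PORT@3-TORS-DEEP-OFF** (take `e = 0`).
[cite: Kim2022StructureSelmer, Thm. 3.13 (arXiv p. 17)] [cite: Kato2004Asterisque, Thm. 12.5 (1)] -/
theorem portDeepOff_of_portDeepOffWitnessAt :
    ∀ (W₀ : WeierstrassCurve ℚ) [W₀.IsElliptic] [W₀.IsGloballyMinimal],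
    (∀ n : ℕ, W₀.HasSurjectiveModNGaloisRep (3 ^ n : ℕ)) →
    ∀ (t M : ℕ), Nat.card {Q : (W₀.baseChange ℚ_[3]).toAffine.Point // (3 : ℕ) • Q = 0} = 3 ^ t →
    ∀ (v₃ : HeightOneSpectrum (𝓞 ℚ)), ((3 : ℕ) : 𝓞 ℚ) ∈ v₃.asIdeal →
    (∀ Q : (W₀.baseChange (v₃.adicCompletion ℚ)).toAffine.Point, 3 ^ (M + 1) • Q = 0 → 3 ^ M • Q = 0) →
    ∀ (η : (q : HeightOneSpectrum (𝓞 ℚ)) → (ZMod (Ideal.absNorm q.asIdeal))ˣ),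
      (∀ q, Subgroup.zpowers (η q) = ⊤) →
    ∀ {N : ℕ} [NeZero N] (P : ModularParametrizationData W₀ N), N = W₀.conductorNorm ℤ →
      (∀ z ∈ P.L.lattice, ∃ w ∈ periodLattice P.f, z = P.c * w) →
      ¬ ((haveI : Fact (Nat.Prime 3) := ⟨Nat.prime_three⟩; Addv W₀ 3) ∧
          ¬ 3 ∣ (W₀.baseChange ℚ_[3]).localTamagawaNumber ℤ_[3] ∧
          Nat.card {Q : (W₀.baseChange ℚ_[3]).toAffine.Point // (3 : ℕ) • Q = 0} = 1 ∧
          ¬ (3 : ℤ) ∣ P.maninConstant) →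
      ∃ e : ℕ, ∀ (k k' : ℕ)
        (Dk : KolyvaginDatum (W₀.torsionGaloisModule (((3 : ℕ) : ℤ) ^ k * ((3 : ℕ) : ℤ))))
        (Dk' : KolyvaginDatum (W₀.torsionGaloisModule (((3 : ℕ) : ℤ) ^ k' * ((3 : ℕ) : ℤ))))
        (red : (W₀.torsionGaloisModule (((3 : ℕ) : ℤ) ^ k' * ((3 : ℕ) : ℤ))).toContRepresentation →ⁱL
          (W₀.torsionGaloisModule (((3 : ℕ) : ℤ) ^ k * ((3 : ℕ) : ℤ))).toContRepresentation),
        Dk.IsCanonicalTauDatumThreeAtWith W₀ (k + M) k η → Dk'.IsCanonicalTauDatumThreeAtWith W₀ (k' + M) k' η →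
        k ≤ k' →
        (∀ x : geomTorsion W₀ (((3 : ℕ) : ℤ) ^ k' * ((3 : ℕ) : ℤ)),
          ((red x : geomTorsion W₀ (((3 : ℕ) : ℤ) ^ k * ((3 : ℕ) : ℤ))) : geomPoints W₀) =
            (((3 : ℕ) : ℤ) ^ (k' - k)) • (x : geomPoints W₀)) →
        ∃ κ Λ κ' κu Λu κu',
          KatoKuriharaWitnessAtTwoExp W₀ k t e Dk v₃ P κ Λ κ' ∧
          KatoKuriharaWitnessAtTwoExp W₀ k' t e Dk' v₃ P κu Λu κu' ∧
          ∀ d, Dk'.IsLevel d → Dk.IsLevel d →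
            galoisCohomology.map red 1 (κu d) = κ d ∧ galoisCohomology.map red 1 (κu' d) = κ' d := by
  intro W₀ _ _ htow t M ht v₃ hv₃ hM η hη N _ P hN hopt hoff
  refine ⟨0, fun k k' Dk Dk' red hDk hDk' hk hred => ?_⟩
  obtain ⟨κ, Λ, κ', κu, Λu, κu', hW, hW', hcomp⟩ := hO W₀ htow t M ht v₃ hv₃ hM η hη P hN hopt hoff k k' Dk Dk'
    red hDk hDk' hk hred
  exact ⟨κ, Λ, κ', κu, Λu, κu', katoKuriharaWitnessAtTwoExp_zero_of_witnessAt hW,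
    katoKuriharaWitnessAtTwoExp_zero_of_witnessAt hW', hcomp⟩

end ItemOff

end Summit.BirchSwinnertonDyer.BirchSwinnertonDyer.Theorems.KimAtThreeDeepLowerPortDeepTorsionItem

end
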